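import Literature.AlgebraicGeometry.Resolution.HenselizationImmediateProofs
import Literature.AlgebraicGeometry.Resolution.ValuationRingsApproximation
import HarnessLib

/-!
# A valued field of rank one is dense in its henselization (Kuhlmann 2010, Lemma 2.4) — proof

Topic: `Literature/AlgebraicGeometry/Resolution` (valued function fields). F.-V. Kuhlmann,
*Elimination of ramification I: The generalized stability theorem*, Trans. AMS 362 (2010)
5697–5727 = arXiv:1003.5678, §2.1, **Lemma 2.4**: "If `(K,v)` is a valued field of rank `1`,
then `K` is dense in its henselization." (There quoted from general valuation theory; the
usual proof embeds `K^h` into the completion, which is henselian in rank one.) It is the first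
half of Lemma 4.4 of the source ("Since `(K(x),v)` is of rank 1, we know from Lemma 2.4 that it
is dense in `K(x)^h`"), on which the Artin–Schreier and Kummer normal forms of §4.1 — hence
Cor. 4.2 in the value-transcendental case, `Kuhlmann2010GaloisDegreePDefectlessVT`
(`NormalDegreePDefectlessVT.lean`) — rest.

We give a direct Galois-theoretic proof inside the ambient rendering of `Henselization.lean`
(`E ≤ Ω`, `Ω` algebraically closed with valuation ring `V`, `E^h = henselization V E` the
decomposition field of `V ∩ E^sep`), refining the first-order approximation of
`HenselizationImmediateProofs.lean` (`|a - b| < |a|`) to approximation to ARBITRARY order under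
the rank-one hypothesis:

* Finite level (`decompositionField_dense`): `N | K` finite Galois with group `G`, `W` a
  valuation ring of `N` whose valuation is archimedean, `v` non-trivial on `K`, `a ∈ N` fixed by
  the decomposition group `D = {σ : σ • W = W}`. The conjugates `σ • W` are pairwise
  incomparable (`eq_of_le_of_comap_eq`), so weak approximation (`exists_crt_of_forall_le_imp_eq`)
  gives `e ≡ 1 mod 𝔪_W` lying in the maximal ideal of every other conjugate; with `π ∈ K`,
  `0 < |π| < 1`, and `k` large (archimedean), `a₀ = e^k/π` has `|a₀|_W > 1` and `|σ a₀|_W < 1`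
  for all `σ ∉ D`; then `wₙ = a₀ⁿ/(1 + a₀ⁿ)` tends to `1` at `W` and to `0` at the other
  conjugates (strong approximation). By Dedekind's independence of characters there is `y ∈ N`
  with `∑_{θ ∈ D} θ y = 1`. The `G`-invariant element `c = ∑_{σ ∈ G} σ(y · wₙ · a) ∈ K` satisfies
  `a - c = ∑_{θ ∈ D} θ(y)·θ(a - wₙ a) - ∑_{σ ∉ D} σ(y wₙ a)`, every term of which is `< |d|_W`
  for `n` large — for `θ ∈ D` because `θ` preserves `W`-inequalities and `|a - wₙ a| = |a|·|a₀|⁻ⁿ`,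
  for `σ ∉ D` because `|σ wₙ| = |σ a₀|ⁿ`. PROVED.
* Ambient level (`exists_mem_valuation_sub_lt_of_mem_henselization_of_archimedean`): for
  `a ∈ E^h` and `d ≠ 0` algebraic over `E`, there is `b ∈ E` with `|a - b| < |d|`, provided the
  valuation is non-trivial on `E` and archimedean on the elements algebraic over `E` (the
  rank-one hypothesis in the form it passes to algebraic extensions). Reduction to the finite
  level exactly as in `exists_mem_valuation_sub_lt_of_mem_henselization` (a finite Galois
  subextension `M ∋ a` of `E^sep | E`; `a` is fixed by the decomposition group of `V ∩ M` by the
  conjugation theorem over `M`). PROVED.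

## Sources

* F.-V. Kuhlmann, *Elimination of ramification I*, Trans. AMS 362 (2010) = arXiv:1003.5678,
  Lemma 2.4 (p. 5), Lemma 4.4 (p. 12). [Kuhlmann2010]
* The strong-from-weak approximation trick `a₀ⁿ/(1 + a₀ⁿ)` and the trace-type averaging are the
  classical ones (Bourbaki, *Alg. comm.* VI §7; Zariski–Samuel II, VI §7). [folklore]

No definition is introduced; no statement of `Henselization.lean` is touched.
-/

noncomputable section

open scoped Pointwise

namespace Literature.AlgebraicGeometry.Resolution

universe u

/-! ### Archimedean bookkeeping for one valuation -/

section Archimedean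

variable {N : Type u} [Field N] (W : ValuationSubring N)

/-- In an archimedean value group: for `|t| > 1` and `B ≠ 0`, `|A| < |B|·|t|ⁿ` for all large
`n`. [folklore] -/
theorem exists_forall_lt_mul_pow
    (harch : ∀ y z : N, 1 < W.valuation y → ∃ n : ℕ, W.valuation z ≤ W.valuation y ^ n)
    {t : N} (ht : 1 < W.valuation t) (A B : N) (hB : B ≠ 0) :
    ∃ n₀ : ℕ, ∀ n, n₀ ≤ n → W.valuation A < W.valuation B * W.valuation t ^ n := by
  obtain ⟨n, hn⟩ := harch t (A / B) ht
  have hBv : 0 < W.valuation B := (Valuation.pos_iff _).mpr hB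
  refine ⟨n + 1, fun m hm => ?_⟩
  have hA : W.valuation A = W.valuation (A / B) * W.valuation B := by
    rw [map_div₀, div_mul_cancel₀ _ hBv.ne']
  rw [hA, mul_comm]
  gcongr
  calc W.valuation (A / B) ≤ W.valuation t ^ n := hn
    _ < W.valuation t ^ m := pow_lt_pow_right₀ ht (by omega)

/-- In an archimedean value group: for `|t| < 1` and `B ≠ 0`, `|A|·|t|ⁿ < |B|` for all large
`n`. [folklore] -/
theorem exists_forall_mul_pow_lt
    (harch : ∀ y z : N, 1 < W.valuation y → ∃ n : ℕ, W.valuation z ≤ W.valuation y ^ n)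
    {t : N} (ht : W.valuation t < 1) (A B : N) (hB : B ≠ 0) :
    ∃ n₀ : ℕ, ∀ n, n₀ ≤ n → W.valuation A * W.valuation t ^ n < W.valuation B := by
  have hBv : 0 < W.valuation B := (Valuation.pos_iff _).mpr hB
  by_cases ht0 : W.valuation t = 0
  · refine ⟨1, fun n hn => ?_⟩
    rw [ht0, zero_pow (by omega), mul_zero]
    exact hBv
  · have htpos : 0 < W.valuation t := zero_lt_iff.mpr ht0
    have hti : 1 < W.valuation t⁻¹ := by
      rw [map_inv₀]
      exact one_lt_inv_iff₀.mpr ⟨htpos, ht⟩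
    obtain ⟨n₀, hn₀⟩ := exists_forall_lt_mul_pow W harch hti A B hB
    refine ⟨n₀, fun n hn => ?_⟩
    have h := hn₀ n hn
    rw [map_inv₀, inv_pow] at h
    have hpow : 0 < W.valuation t ^ n := pow_pos htpos n
    calc W.valuation A * W.valuation t ^ n
        < W.valuation B * (W.valuation t ^ n)⁻¹ * W.valuation t ^ n := by gcongr
      _ = W.valuation B := by rw [mul_assoc, inv_mul_cancel₀ hpow.ne', mul_one]

end Archimedean

/-! ### The finite level: strong approximation and averaging over the Galois group -/

section Finite

variable {K N : Type u} [Field K] [Field N] [Algebra K N] [FiniteDimensional K N]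

open scoped Classical in
/-- **Dedekind's independence of characters**, as used here: for a subgroup `D` of
`Gal(N|K)` there is `e ∈ N` with `∑_{θ ∈ D} θ e ≠ 0`. [folklore] -/
theorem exists_sum_algEquiv_apply_ne_zero (D : Subgroup (N ≃ₐ[K] N)) :
    ∃ e : N, ∑ θ : D, (θ : N ≃ₐ[K] N) e ≠ 0 := by
  classical
  by_contra h
  push Not at h
  set f : D → (N →* N) := fun θ => ((θ : N ≃ₐ[K] N) : N →* N) with hf_def
  have hfapp : ∀ (θ : D) (z : N), f θ z = (θ : N ≃ₐ[K] N) z := fun _ _ => rfl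
  have hf : Function.Injective f := by
    intro θ₁ θ₂ h12
    apply Subtype.ext
    apply AlgEquiv.ext
    intro z
    rw [← hfapp, ← hfapp, h12]
  have hli := (linearIndependent_monoidHom N N).comp f hf
  have hsum : ∑ θ ∈ (Finset.univ : Finset D),
      (1 : N) • ((fun g : N →* N => (g : N → N)) ∘ f) θ = 0 := by
    funext z
    rw [Finset.sum_apply, Pi.zero_apply]
    simp only [Function.comp_apply, Pi.smul_apply, smul_eq_mul, one_mul]
    rw [← h z]
    exact Finset.sum_congr rfl fun θ _ => hfapp θ z
  have h1 := linearIndependent_iff'.mp hli Finset.univ (fun _ => (1 : N)) hsum ⟨1, D.one_mem⟩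
    (Finset.mem_univ _)
  exact one_ne_zero h1

open scoped Classical in
/-- There is `y ∈ N` with `∑_{θ ∈ D} θ y = 1`: take `y = e/s` for `s = ∑_{θ ∈ D} θ e ≠ 0`, which
is `D`-invariant. [folklore] -/
theorem exists_sum_algEquiv_apply_eq_one (D : Subgroup (N ≃ₐ[K] N)) :
    ∃ y : N, ∑ θ : D, (θ : N ≃ₐ[K] N) y = 1 := by
  classical
  obtain ⟨e, he⟩ := exists_sum_algEquiv_apply_ne_zero D
  set s : N := ∑ θ : D, (θ : N ≃ₐ[K] N) e with hs
  have hinv : ∀ θ : D, (θ : N ≃ₐ[K] N) s = s := by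
    intro θ
    rw [hs, map_sum]
    exact Fintype.sum_equiv (Equiv.mulLeft θ) _ _ fun θ' => by
      simp only [Equiv.coe_mulLeft, Subgroup.coe_mul, AlgEquiv.mul_apply]
  refine ⟨e * s⁻¹, ?_⟩
  simp_rw [map_mul, map_inv₀, hinv]
  rw [← Finset.sum_mul, ← hs, mul_inv_cancel₀ he]

/-- **Strong approximation, first step**: in a finite Galois extension `N | K` with a valuation
ring `W` whose valuation is archimedean and non-trivial on `K`, there is `a₀ ∈ N` with
`|a₀|_W > 1` and `|σ a₀|_W < 1` for every `σ` moving `W` (`a₀ = e^k/π` for a weak-approximation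
element `e` and `k` large). [folklore] -/
theorem exists_one_lt_valuation_forall_lt_one [IsGalois K N] (W : ValuationSubring N)
    (harch : ∀ y z : N, 1 < W.valuation y → ∃ n : ℕ, W.valuation z ≤ W.valuation y ^ n)
    {π : K} (hπ0 : algebraMap K N π ≠ 0) (hπ1 : W.valuation (algebraMap K N π) < 1) :
    ∃ a₀ : N, 1 < W.valuation a₀ ∧
      ∀ σ : N ≃ₐ[K] N, σ • W ≠ W → W.valuation (σ a₀) < 1 := by
  classical
  haveI : Algebra.IsAlgebraic K N := Algebra.IsAlgebraic.of_finite K N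
  -- the conjugates of `W`, pairwise incomparable
  set S : Finset (ValuationSubring N) := Finset.univ.image fun σ : N ≃ₐ[K] N => σ • W with hS
  have hWS : W ∈ S := Finset.mem_image.mpr ⟨1, Finset.mem_univ _, one_smul _ _⟩
  have hR : ∀ i j : S, (i : ValuationSubring N) ≤ j → i = j := by
    intro i j hij
    apply Subtype.ext
    obtain ⟨σ, -, hσ⟩ := Finset.mem_image.mp i.2
    obtain ⟨τ, -, hτ⟩ := Finset.mem_image.mp j.2
    refine eq_of_le_of_comap_eq K _ _ hij ?_
    rw [← hσ, ← hτ, comap_smul_algEquiv, comap_smul_algEquiv]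
  -- weak approximation: `e ≡ 1 mod 𝔪_W`, `e ∈ 𝔪_{σ W}` for `σ W ≠ W`
  obtain ⟨e, -, he1, he2⟩ :=
    ValuationSubring.exists_crt_of_forall_le_imp_eq (fun i : S => (i : ValuationSubring N)) hR
      ⟨W, hWS⟩
  have hve : W.valuation e = 1 := by
    have h := Valuation.map_eq_of_sub_lt W.valuation (x := (1 : N)) (y := e) (by rwa [map_one])
    rwa [map_one] at h
  have he0 : e ≠ 0 := fun h => by
    rw [h, map_zero] at hve
    exact zero_ne_one hve
  have he2' : ∀ σ : N ≃ₐ[K] N, σ • W ≠ W → W.valuation (σ⁻¹ • e) < 1 := by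
    intro σ hσ
    have hmem : σ • W ∈ S := Finset.mem_image.mpr ⟨σ, Finset.mem_univ _, rfl⟩
    have hne : (⟨σ • W, hmem⟩ : S) ≠ ⟨W, hWS⟩ := fun h => hσ (congrArg Subtype.val h)
    exact (valuation_smul_lt_one_iff σ W e).mp (he2 ⟨σ • W, hmem⟩ hne)
  have hπpos : 0 < W.valuation (algebraMap K N π) := (Valuation.pos_iff _).mpr hπ0
  -- an exponent `k` with `|σ⁻¹ e|^k < |π|` for all `σ` moving `W`
  have hk : ∃ k : ℕ, ∀ σ : N ≃ₐ[K] N, σ • W ≠ W →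
      W.valuation (σ⁻¹ • e) ^ k < W.valuation (algebraMap K N π) := by
    have hpt : ∀ σ : N ≃ₐ[K] N, ∃ n : ℕ, σ • W ≠ W → ∀ m, n ≤ m →
        W.valuation (σ⁻¹ • e) ^ m < W.valuation (algebraMap K N π) := by
      intro σ
      by_cases hσ : σ • W = W
      · exact ⟨0, fun h => absurd hσ h⟩
      · have hlt := he2' σ hσ
        obtain ⟨n, hn⟩ := exists_forall_mul_pow_lt W harch hlt 1 (algebraMap K N π) hπ0
        refine ⟨n, fun _ m hm => ?_⟩
        have := hn m hm
        rwa [map_one, one_mul] at this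
    choose n hn using hpt
    exact ⟨Finset.univ.sup n, fun σ hσ => hn σ hσ _ (Finset.le_sup (Finset.mem_univ σ))⟩
  obtain ⟨k, hk⟩ := hk
  refine ⟨e ^ k / algebraMap K N π, ?_, fun σ hσ => ?_⟩
  · rw [map_div₀, map_pow, hve, one_pow, one_div]
    exact one_lt_inv_iff₀.mpr ⟨hπpos, hπ1⟩
  · -- `σ⁻¹` also moves `W`
    have hσ' : σ⁻¹ • W ≠ W := by
      intro h
      apply hσ
      have := congrArg (fun A => σ • A) h
      simpa only [smul_inv_smul] using this.symm
    have h1 := hk σ⁻¹ hσ'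
    rw [inv_inv, AlgEquiv.smul_def] at h1
    rw [map_div₀, map_pow, AlgEquiv.commutes, map_div₀, map_pow, div_lt_one₀ hπpos]
    exact h1

omit [FiniteDimensional K N] in
/-- For `θ` in the decomposition group of `W`, `θ` preserves strict `W`-inequalities:
`|z|_W < |z'|_W ↔ |θ z|_W < |θ z'|_W`. [folklore] -/
theorem valuation_lt_iff_of_smul_eq {θ : N ≃ₐ[K] N} {W : ValuationSubring N} (hθ : θ • W = W)
    (z z' : N) : W.valuation z < W.valuation z' ↔ W.valuation (θ z) < W.valuation (θ z') := by
  have h := smul_valuation_lt_iff θ W (θ z) (θ z')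
  rw [hθ, AlgEquiv.smul_def, AlgEquiv.smul_def, ← AlgEquiv.mul_apply,
    ← AlgEquiv.mul_apply, inv_mul_cancel, AlgEquiv.one_apply, AlgEquiv.one_apply] at h
  exact h.symm

/-- **Kuhlmann 2010, Lemma 2.4 at the finite level: the base field is dense in the
decomposition field (rank one).** Let `N | K` be finite Galois, `W` a valuation ring of `N`
whose valuation is archimedean (`|y| > 1 ⇒ ∀ z ∃ n, |z| ≤ |y|ⁿ`) and non-trivial on `K`. Then
every `a ∈ N` fixed by the decomposition group `{σ : σ • W = W}` is approximated by elements
of `K` to arbitrary order: for every `d ≠ 0` there is `c ∈ K` with `|a - c|_W < |d|_W`. Proof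
(module docstring): strong approximation `wₙ = a₀ⁿ/(1 + a₀ⁿ)`, `y` with `∑_{θ ∈ D} θ y = 1`
(Dedekind), and the `Gal(N|K)`-invariant `c = ∑_σ σ(y wₙ a)`. [cite: Kuhlmann2010, Lemma 2.4] -/
theorem decompositionField_dense [IsGalois K N] (W : ValuationSubring N)
    (harch : ∀ y z : N, 1 < W.valuation y → ∃ n : ℕ, W.valuation z ≤ W.valuation y ^ n)
    (hπ : ∃ π : K, algebraMap K N π ≠ 0 ∧ W.valuation (algebraMap K N π) < 1)
    {a : N} (ha : ∀ σ ∈ W.decompositionSubgroup K, σ • a = a) {d : N} (hd : d ≠ 0) :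
    ∃ c : K, W.valuation (a - algebraMap K N c) < W.valuation d := by
  classical
  obtain ⟨π, hπ0, hπ1⟩ := hπ
  set D : Subgroup (N ≃ₐ[K] N) := W.decompositionSubgroup K with hD
  have hmemD : ∀ σ : N ≃ₐ[K] N, σ ∈ D ↔ σ • W = W := fun σ => MulAction.mem_stabilizer_iff
  obtain ⟨y, hy⟩ := exists_sum_algEquiv_apply_eq_one D
  obtain ⟨a₀, ha₀, ha₀σ⟩ := exists_one_lt_valuation_forall_lt_one W harch hπ0 hπ1
  have hdv : 0 < W.valuation d := (Valuation.pos_iff _).mpr hd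
  -- the exponent `n`: constraints (C1) for `θ ∈ D`, (C2) for `σ ∉ D`
  have hC1 : ∀ θ : N ≃ₐ[K] N, ∃ n₀ : ℕ, ∀ n, n₀ ≤ n →
      W.valuation (y * a) < W.valuation (θ⁻¹ d) * W.valuation a₀ ^ n := fun θ =>
    exists_forall_lt_mul_pow W harch ha₀ (y * a) (θ⁻¹ d)
      (by rw [Ne, map_eq_zero_iff _ θ⁻¹.injective]; exact hd)
  have hC2 : ∀ σ : N ≃ₐ[K] N, ∃ n₀ : ℕ, σ • W ≠ W → ∀ n, n₀ ≤ n →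
      W.valuation (σ y * σ a) * W.valuation (σ a₀) ^ n < W.valuation d := by
    intro σ
    by_cases hσ : σ • W = W
    · exact ⟨0, fun h => absurd hσ h⟩
    · obtain ⟨n₀, hn₀⟩ := exists_forall_mul_pow_lt W harch (ha₀σ σ hσ) (σ y * σ a) d hd
      exact ⟨n₀, fun _ => hn₀⟩
  choose n₁ hn₁ using hC1
  choose n₂ hn₂ using hC2
  set n : ℕ := max (Finset.univ.sup n₁) (Finset.univ.sup n₂) + 1 with hn
  have hn1 : ∀ θ, n₁ θ ≤ n := fun θ =>
    (Finset.le_sup (f := n₁) (Finset.mem_univ θ)).trans ((le_max_left _ _).trans (Nat.le_succ _))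
  have hn2 : ∀ σ, n₂ σ ≤ n := fun σ =>
    (Finset.le_sup (f := n₂) (Finset.mem_univ σ)).trans ((le_max_right _ _).trans (Nat.le_succ _))
  have hnpos : 1 ≤ n := Nat.le_add_left 1 _
  -- `w = a₀ⁿ/(1 + a₀ⁿ)`, `b = w a`, `c' = ∑_σ σ (y b)`
  have ha₀n : 1 < W.valuation (a₀ ^ n) := by
    rw [map_pow]
    exact one_lt_pow₀ ha₀ (by omega)
  have hden : W.valuation (1 + a₀ ^ n) = W.valuation a₀ ^ n := by
    rw [Valuation.map_add_eq_of_lt_right _ (by rwa [map_one]), map_pow]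
  have hden0 : (1 : N) + a₀ ^ n ≠ 0 := fun h => by
    rw [h, map_zero] at hden
    exact (pow_pos (zero_lt_one.trans ha₀) n).ne hden
  obtain ⟨w, hw⟩ : ∃ w : N, w = a₀ ^ n / (1 + a₀ ^ n) := ⟨_, rfl⟩
  have hw1 : W.valuation (w - 1) = (W.valuation a₀ ^ n)⁻¹ := by
    have : w - 1 = -(1 / (1 + a₀ ^ n)) := by
      rw [hw]
      field_simp
      ring
    rw [this, Valuation.map_neg, map_div₀, map_one, hden, one_div]
  have hσw : ∀ σ : N ≃ₐ[K] N, σ • W ≠ W → W.valuation (σ w) = W.valuation (σ a₀) ^ n := by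
    intro σ hσ
    have hlt : W.valuation (σ a₀ ^ n) < 1 := by
      rw [map_pow]
      exact pow_lt_one₀ zero_le (ha₀σ σ hσ) (by omega)
    rw [hw, map_div₀, map_add, map_one, map_pow, map_div₀,
      Valuation.map_add_eq_of_lt_left _ (by rwa [map_one]), map_one, div_one, map_pow]
  obtain ⟨b, hb⟩ : ∃ b : N, b = w * a := ⟨_, rfl⟩
  obtain ⟨c', hc'⟩ : ∃ c' : N, c' = ∑ σ : N ≃ₐ[K] N, σ (y * b) := ⟨_, rfl⟩
  -- `c'` is `Gal(N|K)`-invariant, hence in `K`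
  have hfix : ∀ ρ : N ≃ₐ[K] N, ρ c' = c' := by
    intro ρ
    rw [hc', map_sum]
    exact Fintype.sum_bijective (ρ * ·) (Group.mulLeft_bijective ρ) _ _ fun σ => rfl
  obtain ⟨c, hc⟩ := (IsGalois.mem_range_algebraMap_iff_fixed c').mpr hfix
  refine ⟨c, ?_⟩
  rw [hc]
  -- `a - c' = ∑_{θ ∈ D} θ y (a - θ b) - ∑_{σ ∉ D} σ y σ b`
  have hy' : ∑ σ ∈ Finset.univ.filter (· ∈ D), σ y = 1 := by
    rw [← hy, Finset.sum_subtype (Finset.univ.filter (· ∈ D)) (p := (· ∈ D))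
      (fun σ => by simp only [Finset.mem_filter, Finset.mem_univ, true_and])]
  have hsplit : a - c' =
      ∑ σ ∈ Finset.univ.filter (· ∈ D), σ y * (a - σ b) -
        ∑ σ ∈ Finset.univ.filter (fun σ => ¬ σ ∈ D), σ (y * b) := by
    have h1 : a = ∑ σ ∈ Finset.univ.filter (· ∈ D), σ y * a := by
      rw [← Finset.sum_mul, hy', one_mul]
    have h2 : c' = ∑ σ ∈ Finset.univ.filter (· ∈ D), σ (y * b) +
        ∑ σ ∈ Finset.univ.filter (fun σ => ¬ σ ∈ D), σ (y * b) := by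
      rw [hc', Finset.sum_filter_add_sum_filter_not]
    conv_lhs => rw [h1, h2]
    rw [← sub_sub, ← Finset.sum_sub_distrib]
    congr 1
    refine Finset.sum_congr rfl fun σ _ => ?_
    rw [map_mul, mul_sub]
  rw [hsplit]
  refine lt_of_le_of_lt (Valuation.map_sub _ _ _) (max_lt ?_ ?_)
  · -- the terms with `θ ∈ D`
    refine Valuation.map_sum_lt _ hdv.ne' fun θ hθ => ?_
    have hθD : θ • W = W := (hmemD θ).mp (Finset.mem_filter.mp hθ).2
    have hθa : θ a = a := ha θ ((hmemD θ).mpr hθD)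
    have heq : θ y * (a - θ b) = θ (y * (a - b)) := by
      rw [map_mul, map_sub, hθa]
    rw [heq]
    -- transfer through `θ`: it suffices that `|y (a - b)| < |θ⁻¹ d|`
    have hθ' : θ⁻¹ • W = W := by
      have := congrArg (fun A => θ⁻¹ • A) hθD
      simpa only [inv_smul_smul] using this.symm
    have key : W.valuation (y * (a - b)) < W.valuation (θ⁻¹ d) := by
      have hab : a - b = -(a * (w - 1)) := by rw [hb]; ring
      rw [hab, mul_neg, Valuation.map_neg, ← mul_assoc, map_mul, hw1]
      have h := hn₁ θ n (hn1 θ)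
      have hpow : 0 < W.valuation a₀ ^ n := pow_pos (zero_lt_one.trans ha₀) n
      calc W.valuation (y * a) * (W.valuation a₀ ^ n)⁻¹
          < W.valuation (θ⁻¹ d) * W.valuation a₀ ^ n * (W.valuation a₀ ^ n)⁻¹ :=
            mul_lt_mul_of_pos_right h (zero_lt_iff.mpr (inv_ne_zero hpow.ne'))
        _ = W.valuation (θ⁻¹ d) := by rw [mul_assoc, mul_inv_cancel₀ hpow.ne', mul_one]
    have h2 := (valuation_lt_iff_of_smul_eq hθD (y * (a - b)) (θ⁻¹ d)).mp key
    rwa [← AlgEquiv.mul_apply, mul_inv_cancel, AlgEquiv.one_apply] at h2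
  · -- the terms with `σ ∉ D`
    refine Valuation.map_sum_lt _ hdv.ne' fun σ hσ => ?_
    have hσD : σ • W ≠ W := fun h => (Finset.mem_filter.mp hσ).2 ((hmemD σ).mpr h)
    have hval : W.valuation (σ (y * b)) = W.valuation (σ y * σ a) * W.valuation (σ a₀) ^ n := by
      simp only [hb, map_mul, hσw σ hσD]
      ac_rfl
    rw [hval]
    exact hn₂ σ hσD n (hn2 σ)

end Finite

/-! ### The ambient level: `E` is dense in `E^h` (rank one) -/

section Ambient

variable {Ω : Type u} [Field Ω] [IsAlgClosed Ω] (V : ValuationSubring Ω) (E : Subfield Ω)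

/-- **Kuhlmann 2010, Lemma 2.4: a valued field of rank one is dense in its henselization**, in
the ambient rendering of `Henselization.lean`: let `E ≤ Ω` (`Ω` algebraically closed with
valuation ring `V`) be such that the valuation is non-trivial on `E` and archimedean on the
elements of `Ω` algebraic over `E` (this is "rank one" of `(E, V ∩ E)` as it passes to the
algebraic closure). Then for every `a ∈ E^h = henselization V E` and every `d ≠ 0` algebraic over
`E` there is `b ∈ E` with `|a - b| < |d|`. Reduction to `decompositionField_dense` through a
finite Galois subextension `M ∋ a` of `E^sep | E` (as in
`exists_mem_valuation_sub_lt_of_mem_henselization`) and a power `πᵐ` of a non-unit `π ∈ E` with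
`|πᵐ| ≤ |d|`. [cite: Kuhlmann2010, Lemma 2.4] -/
theorem exists_mem_valuation_sub_lt_of_mem_henselization_of_archimedean
    (harch : ∀ y z : Ω, IsAlgebraic E y → IsAlgebraic E z → 1 < V.valuation y →
      ∃ n : ℕ, V.valuation z ≤ V.valuation y ^ n)
    (hπ : ∃ π ∈ E, π ≠ 0 ∧ V.valuation π < 1)
    {a : Ω} (ha : a ∈ henselization V E) {d : Ω} (hdE : IsAlgebraic E d) (hd : d ≠ 0) :
    ∃ b ∈ E, V.valuation (a - b) < V.valuation d := by
  classical
  obtain ⟨π, hπE, hπ0, hπ1⟩ := hπ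
  -- a power of `π` below `d`
  obtain ⟨m, hm⟩ : ∃ m : ℕ, V.valuation (π ^ m) ≤ V.valuation d := by
    have hπalg : IsAlgebraic E π⁻¹ := isAlgebraic_algebraMap (⟨π⁻¹, E.inv_mem hπE⟩ : E)
    have h1 : 1 < V.valuation π⁻¹ := by
      rw [map_inv₀]
      exact one_lt_inv_iff₀.mpr ⟨(Valuation.pos_iff _).mpr hπ0, hπ1⟩
    obtain ⟨m, hm⟩ := harch π⁻¹ d⁻¹ hπalg hdE.inv h1
    refine ⟨m, ?_⟩
    rw [map_inv₀, map_inv₀, inv_pow] at hm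
    rw [map_pow]
    exact (inv_le_inv₀ ((Valuation.pos_iff _).mpr hd)
      (pow_pos ((Valuation.pos_iff _).mpr hπ0) m)).mp hm
  suffices h : ∃ b ∈ E, V.valuation (a - b) < V.valuation (π ^ m) by
    obtain ⟨b, hb, hlt⟩ := h
    exact ⟨b, hb, lt_of_lt_of_le hlt hm⟩
  obtain ⟨haS, hfix⟩ := (mem_henselization_iff V E).mp ha
  -- the Galois extension `L = E^sep` of `E`, its valuation ring `VL = V ∩ L`, and `x = a ∈ L`
  set L : IntermediateField E Ω := separableClosure E Ω with hL_def
  set VL : ValuationSubring L := sepClosureValuationSubring V E with hVL_def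
  set x : L := ⟨a, haS⟩ with hx_def
  -- a finite Galois subextension `M ∋ x`
  let M : FiniteGaloisIntermediateField E L := FiniteGaloisIntermediateField.adjoin E {x}
  have hxM : x ∈ M.toIntermediateField := FiniteGaloisIntermediateField.subset_adjoin E {x} rfl
  set xM : M := ⟨x, hxM⟩ with hxM_def
  -- the valuation ring `W = V ∩ M` of `M`
  set W : ValuationSubring M := VL.comap (algebraMap M L) with hW_def
  have hW' : W = V.comap ((algebraMap L Ω).comp (algebraMap M L)) := by
    rw [hW_def, hVL_def, sepClosureValuationSubring, ValuationSubring.comap_comap]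
  have hcoe : ∀ z : M, ((algebraMap L Ω).comp (algebraMap M L)) z = ((z : L) : Ω) := fun _ => rfl
  -- `xM` is fixed by the decomposition group of `W` in `Gal(M|E)`
  have hfixM : ∀ ρ ∈ W.decompositionSubgroup E, ρ • xM = xM := by
    intro ρ hρ
    have hρW : ρ • W = W := MulAction.mem_stabilizer_iff.mp hρ
    set ρ' : L ≃ₐ[E] L := ρ.liftNormal L with hρ'_def
    have hρ'inv : ∀ y : M, ρ'⁻¹ (algebraMap M L y) = algebraMap M L (ρ⁻¹ y) := by
      intro y
      rw [AlgEquiv.aut_inv, AlgEquiv.symm_apply_eq, hρ'_def, AlgEquiv.liftNormal_commutes,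
        AlgEquiv.aut_inv, AlgEquiv.apply_symm_apply]
    have hagree : VL.comap (algebraMap M L) = (ρ' • VL).comap (algebraMap M L) := by
      ext y
      rw [ValuationSubring.mem_comap, ValuationSubring.mem_comap,
        ValuationSubring.mem_pointwise_smul_iff_inv_smul_mem, AlgEquiv.smul_def, hρ'inv]
      change y ∈ W ↔ ρ⁻¹ • y ∈ W
      rw [← ValuationSubring.mem_pointwise_smul_iff_inv_smul_mem (g := ρ), hρW]
    obtain ⟨θ, hθ⟩ := exists_smul_eq_of_isGalois M VL (ρ' • VL) hagree
    have hθ' : ∀ z : L, (θ.restrictScalars E)⁻¹ • z = θ⁻¹ • z := by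
      intro z
      rw [AlgEquiv.smul_def, AlgEquiv.smul_def, AlgEquiv.aut_inv, AlgEquiv.aut_inv,
        AlgEquiv.symm_apply_eq, AlgEquiv.restrictScalars_apply, AlgEquiv.apply_symm_apply]
    have hθE : (θ.restrictScalars E) • VL = θ • VL := by
      ext z
      rw [ValuationSubring.mem_pointwise_smul_iff_inv_smul_mem,
        ValuationSubring.mem_pointwise_smul_iff_inv_smul_mem, hθ']
    set σ : L ≃ₐ[E] L := ρ'⁻¹ * θ.restrictScalars E with hσ_def
    have hσ : σ • VL = VL := by
      rw [hσ_def, mul_smul, hθE, hθ, inv_smul_smul]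
    have hσx : σ x = x := hfix σ ((mem_decompositionGroup_iff V E σ).mpr hσ)
    have hθx : θ x = x := θ.commutes xM
    have hρ'x : ρ' x = x := by
      rw [hσ_def, AlgEquiv.mul_apply, AlgEquiv.restrictScalars_apply, hθx, AlgEquiv.aut_inv,
        AlgEquiv.symm_apply_eq] at hσx
      exact hσx.symm
    rw [AlgEquiv.smul_def]
    apply (algebraMap M L).injective
    rw [← AlgEquiv.liftNormal_commutes, ← hρ'_def]
    exact hρ'x
  -- the hypotheses of the finite level
  have harchW : ∀ y z : M, 1 < W.valuation y → ∃ n : ℕ, W.valuation z ≤ W.valuation y ^ n := by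
    intro y z hy
    have halg : ∀ t : M, IsAlgebraic E (((t : L) : Ω)) := fun t =>
      (Algebra.IsAlgebraic.isAlgebraic (R := E) t).algHom (IsScalarTower.toAlgHom E M Ω)
    have hy' : 1 < V.valuation ((y : L) : Ω) := by
      have h := (comap_valuation_lt_iff V ((algebraMap L Ω).comp (algebraMap M L)) 1 y)
      rw [← hW', map_one, map_one] at h
      exact h.mp hy
    obtain ⟨n, hn⟩ := harch _ _ (halg y) (halg z) hy'
    refine ⟨n, ?_⟩
    rw [← map_pow, hW', comap_valuation_le_iff, map_pow, map_pow]
    exact hn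
  have hπW : ∃ π' : E, algebraMap E M π' ≠ 0 ∧ W.valuation (algebraMap E M π') < 1 := by
    refine ⟨⟨π, hπE⟩, fun h => hπ0 ?_, ?_⟩
    · have := congrArg (fun z : M => ((z : L) : Ω)) h
      exact this
    · have h := comap_valuation_lt_iff V ((algebraMap L Ω).comp (algebraMap M L))
        (algebraMap E M ⟨π, hπE⟩) 1
      rw [← hW', map_one, map_one] at h
      exact h.mpr hπ1
  have hdM : (algebraMap E M (⟨π, hπE⟩ ^ m)) ≠ 0 := by
    rw [map_pow]
    refine pow_ne_zero _ fun h => hπ0 ?_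
    have := congrArg (fun z : M => ((z : L) : Ω)) h
    exact this
  -- the finite-level density
  obtain ⟨c, hc⟩ := decompositionField_dense (K := E) W harchW hπW hfixM hdM
  refine ⟨(c : Ω), c.2, ?_⟩
  rw [hW', comap_valuation_lt_iff, map_sub] at hc
  have e1 : ((algebraMap L Ω).comp (algebraMap M L)) xM = a := rfl
  have e2 : ((algebraMap L Ω).comp (algebraMap M L)) (algebraMap E M c) = (c : Ω) := rfl
  have e3 : ((algebraMap L Ω).comp (algebraMap M L)) (algebraMap E M (⟨π, hπE⟩ ^ m)) = π ^ m := by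
    rw [map_pow, map_pow]
    rfl
  rw [e1, e2, e3] at hc
  exact hc

end Ambient

end Literature.AlgebraicGeometry.Resolution
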